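/-
Copyright (c) 2026. All rights reserved.
Released under Apache 2.0 license as described in the file LICENSE.
Authors: abc-iut cell, campaign-S prover seat abc-iut-S6 (wave 2).
-/
import Mathlib.Analysis.SpecialFunctions.Pow.Real
import Literature.NumberTheory.GaloisRepresentations.PadicResidueIndex
import Literature.IUT.LogVolume.TensorPacketRing
import HarnessLib

/-!
# Tensor packets: pure tensors, `p`-powers, the lattice `R_I`, and fractional `p`-powers in `(R_I)^∼`

Mochizuki, *Inter-universal Teichmüller theory IV*, RIMS manuscript (Apr. 2020), §1, kurims pp. 9–11,
Propositions 1.1–1.2: the objects `R_I = ⊗_{ℤ_p} R_i ⊆ V = ⊗_{ℚ_p} k_i`, `(R_I)^∼` (normalisation) and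
the "unspecified elements `p^λ`" of fractional order (p. 9: "for `λ ∈ ℚ` we shall write `p^λ` for some
element of `ℚ̄_p` such that `ord(p^λ) = λ`").  This file is the PROOF-SIDE toolkit over the typed
statements of `TensorPacketRing.lean` (abc-iut-S1); everything here is proved, nothing is re-typed.

* pure tensors (`purePacket`): multiplicativity, powers, scalars pulled out of all slots, `ι_i`;
  integer powers `ppow n = p^n ∈ V` (a unit, `p^{m+n} = p^m p^n`);
* `R_I` (`integerPacket`, the subring generated by pure tensors of integers) is ALREADY the additive
  group generated by them (`mem_integerPacket_iff`, `integerPacket_induction`; no auxiliary definitions — this file is theorems only), contains `p^n`, `n ≥ 0`,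
  and is stable under `ℤ_p`-scalars; `R_I ⊆ (R_I)^∼`; `x^E ∈ R_I ⇒ x ∈ (R_I)^∼`;
* **fractional `p`-powers are integral** (`exists_eq_ppow_mul_of_prod_norm_le`): a pure tensor
  `⊗_i c_i` of nonzero field elements with `Σ_i ord(c_i) ≥ n` (`n ∈ ℤ`; i.e. `∏ ‖c_i‖ ≤ p^{−n}`) is
  `p^n · y` with `y ∈ (R_I)^∼` — because `(p^{−n} ⊗ c_i)^{∏ e_i}` is `p^{(integer ≥ 0)}` times a pure
  tensor of units.  This is how the printed step "`p^λ·(R_I)^∼ ⊆ p^{⌊λ−d_I−a_I⌋}·p^{d_I+a_I}·(R_I)^∼`"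
  (proof of Prop. 1.2 (ii), p. 11), which silently uses that `(R_I)^∼` is a product of integer rings,
  is made honest inside `V` without the direct-sum decomposition; consequences
  `smul_normalizedPacket_subset_of_prod_norm_le` (comparison of `G·(R_I)^∼` for two such `G`).

Classical commutative algebra; the [IUTchIV] locators record where the cell uses it.
-/

noncomputable section

open Metric Set
open scoped Pointwise TensorProduct NormedField

namespace Literature.IUT.LogVolume

open Literature.NumberTheory.GaloisRepresentations.Ultrametric

variable (p : ℕ) [Fact p.Prime]
variable {I : Type}
variable (k : I → Type) [∀ i, NontriviallyNormedField (k i)] [∀ i, NormedAlgebra ℚ_[p] (k i)]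

/-! ## Pure tensors and `p`-powers -/

/-- `⊗x_i · ⊗y_i = ⊗(x_i y_i)`. [claim: Mochizuki2012, status: disputed] -/
theorem purePacket_mul (x y : Π i, k i) :
    purePacket p k x * purePacket p k y = purePacket p k (x * y) :=
  PiTensorProduct.tprod_mul_tprod x y

/-- `⊗ 1 = 1`. [claim: Mochizuki2012, status: disputed] -/
theorem purePacket_one : purePacket p k 1 = 1 := (PiTensorProduct.one_def).symm

/-- `(⊗x_i)^n = ⊗(x_i^n)`. [claim: Mochizuki2012, status: disputed] -/
theorem purePacket_pow (x : Π i, k i) (n : ℕ) :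
    purePacket p k x ^ n = purePacket p k (x ^ n) :=
  (map_pow (PiTensorProduct.tprodMonoidHom ℚ_[p]) x n).symm

/-- `ι_i(g) = 1 ⊗ ⋯ ⊗ g ⊗ ⋯ ⊗ 1`. [claim: Mochizuki2012, status: disputed] -/
theorem iota_eq_purePacket [DecidableEq I] (i : I) (g : k i) :
    iota p k i g = purePacket p k (Pi.mulSingle i g) := rfl

/-- Scalars pull out of every slot: `⊗(c_i • x_i) = (∏ c_i) • ⊗x_i`.
[claim: Mochizuki2012, status: disputed] -/
theorem purePacket_smul [Fintype I] (c : I → ℚ_[p]) (x : Π i, k i) :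
    purePacket p k (fun i ↦ c i • x i) = (∏ i, c i) • purePacket p k x :=
  (PiTensorProduct.tprod ℚ_[p]).map_smul_univ c x

/-- `algebraMap ℚ_p V r = ⊗(r, 1, …, 1)` (the scalar in slot `i`). [claim: Mochizuki2012, status: disputed] -/
theorem algebraMap_eq_purePacket [DecidableEq I] (r : ℚ_[p]) (i : I) :
    algebraMap ℚ_[p] (PacketAlgebra p k) r =
      purePacket p k (Pi.mulSingle i (algebraMap ℚ_[p] (k i) r)) :=
  PiTensorProduct.algebraMap_apply r i

/-- `p^{m+n} = p^m · p^n` in `V`. [claim: Mochizuki2012, status: disputed] -/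
theorem ppow_add (m n : ℤ) : ppow p k (m + n) = ppow p k m * ppow p k n := by
  rw [ppow, ppow, ppow, zpow_add₀ (PadicUniformizer.p_ne_zero' p), map_mul]

/-- `p^0 = 1` in `V`. [claim: Mochizuki2012, status: disputed] -/
theorem ppow_zero : ppow p k 0 = 1 := by rw [ppow, zpow_zero, map_one]

/-- `p^{−n} · p^{n} = 1`. [claim: Mochizuki2012, status: disputed] -/
theorem ppow_neg_mul_self (n : ℤ) : ppow p k (-n) * ppow p k n = 1 := by
  rw [← ppow_add, neg_add_cancel, ppow_zero]

/-- `p^{n} · p^{−n} = 1`. [claim: Mochizuki2012, status: disputed] -/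
theorem ppow_mul_neg_self (n : ℤ) : ppow p k n * ppow p k (-n) = 1 := by
  rw [← ppow_add, add_neg_cancel, ppow_zero]

/-- `p^n` is a unit of `V`. [claim: Mochizuki2012, status: disputed] -/
theorem isUnit_ppow (n : ℤ) : IsUnit (ppow p k n) :=
  IsUnit.of_mul_eq_one _ (ppow_mul_neg_self p k n)

/-- Multiplication by `p^n` is the `ℚ_p`-scalar action of `p^n`. [claim: Mochizuki2012, status: disputed] -/
theorem ppow_mul_eq_smul (n : ℤ) (x : PacketAlgebra p k) :
    ppow p k n * x = ((p : ℚ_[p]) ^ n) • x :=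
  (Algebra.smul_def _ _).symm

/-! ## The lattice `R_I` -/

/-- A pure tensor of integers lies in `R_I`. [claim: Mochizuki2012, status: disputed] -/
theorem purePacket_mem_integerPacket {x : Π i, k i} (hx : ∀ i, ‖x i‖ ≤ 1) :
    purePacket p k x ∈ integerPacket p k :=
  Subring.subset_closure ⟨x, hx, rfl⟩

/-- **`R_I` is the additive group generated by the pure tensors of integers** (these are closed under
multiplication — `⊗1 = 1`, `⊗x·⊗y = ⊗(xy)` — so no further products are needed).
[claim: Mochizuki2012, status: disputed] -/
theorem mem_integerPacket_iff {t : PacketAlgebra p k} :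
    t ∈ integerPacket p k ↔
      t ∈ AddSubgroup.closure {t | ∃ x : Π i, k i, (∀ i, ‖x i‖ ≤ 1) ∧ t = purePacket p k x} := by
  -- the generating set is a multiplicative submonoid
  let M : Submonoid (PacketAlgebra p k) :=
    { carrier := {t | ∃ x : Π i, k i, (∀ i, ‖x i‖ ≤ 1) ∧ t = purePacket p k x}
      one_mem' := ⟨1, fun _ ↦ by simp, (purePacket_one p k).symm⟩
      mul_mem' := by
        rintro _ _ ⟨x, hx, rfl⟩ ⟨y, hy, rfl⟩
        refine ⟨x * y, fun i ↦ ?_, (purePacket_mul p k x y)⟩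
        rw [Pi.mul_apply, norm_mul]
        exact mul_le_one₀ (hx i) (norm_nonneg _) (hy i) }
  have hM : (Submonoid.closure (M : Set (PacketAlgebra p k)) : Set (PacketAlgebra p k)) = M :=
    congrArg SetLike.coe (Submonoid.closure_eq M)
  change t ∈ Subring.closure (M : Set (PacketAlgebra p k)) ↔
    t ∈ AddSubgroup.closure (M : Set (PacketAlgebra p k))
  rw [Subring.mem_closure_iff, hM]

/-- Induction principle for `R_I`: a property stable under `0`, `+`, `−` that holds on pure tensors of
integers holds on `R_I`. [claim: Mochizuki2012, status: disputed] -/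
theorem integerPacket_induction {C : PacketAlgebra p k → Prop}
    (pure : ∀ x : Π i, k i, (∀ i, ‖x i‖ ≤ 1) → C (purePacket p k x)) (zero : C 0)
    (add : ∀ a b, C a → C b → C (a + b)) (neg : ∀ a, C a → C (-a))
    {t : PacketAlgebra p k} (ht : t ∈ integerPacket p k) : C t := by
  rw [mem_integerPacket_iff] at ht
  induction ht using AddSubgroup.closure_induction with
  | mem _ h => obtain ⟨x, hx, rfl⟩ := h; exact pure x hx
  | zero => exact zero
  | add a b _ _ ha hb => exact add a b ha hb
  | neg a _ ha => exact neg a ha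

/-- For `‖r‖ ≤ 1`, the scalar `r ∈ ℚ_p` lies in `R_I` (put it in any slot; `I ≠ ∅`).
[claim: Mochizuki2012, status: disputed] -/
theorem algebraMap_mem_integerPacket [DecidableEq I] [Nonempty I] {r : ℚ_[p]} (hr : ‖r‖ ≤ 1) :
    algebraMap ℚ_[p] (PacketAlgebra p k) r ∈ integerPacket p k := by
  obtain ⟨i⟩ := ‹Nonempty I›
  rw [algebraMap_eq_purePacket p k r i]
  refine purePacket_mem_integerPacket p k fun j ↦ ?_
  by_cases h : j = i
  · subst h; rw [Pi.mulSingle_eq_same, norm_algebraMap']; exact hr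
  · rw [Pi.mulSingle_eq_of_ne h, norm_one]

/-- `p^n ∈ R_I` for `n ≥ 0`. [claim: Mochizuki2012, status: disputed] -/
theorem ppow_mem_integerPacket [DecidableEq I] [Nonempty I] {n : ℤ} (hn : 0 ≤ n) :
    ppow p k n ∈ integerPacket p k := by
  refine algebraMap_mem_integerPacket p k ?_
  rw [Padic.norm_p_zpow]
  exact zpow_le_one_of_nonpos₀ (by exact_mod_cast (Fact.out : p.Prime).one_lt.le) (by omega)

/-- `R_I` is stable under `ℤ_p`-scalars: `‖r‖ ≤ 1 ⇒ r • t ∈ R_I`. [claim: Mochizuki2012, status: disputed] -/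
theorem smul_mem_integerPacket [DecidableEq I] [Nonempty I] {r : ℚ_[p]} (hr : ‖r‖ ≤ 1)
    {t : PacketAlgebra p k} (ht : t ∈ integerPacket p k) : r • t ∈ integerPacket p k := by
  rw [Algebra.smul_def]
  exact mul_mem (algebraMap_mem_integerPacket p k hr) ht

/-! ## The normalisation `(R_I)^∼` -/

/-- Membership in `(R_I)^∼` is integrality over `R_I`. [claim: Mochizuki2012, status: disputed] -/
theorem mem_normalizedPacket_iff {x : PacketAlgebra p k} :
    x ∈ normalizedPacket p k ↔ IsIntegral (integerPacket p k) x := Iff.rfl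

/-- `R_I ⊆ (R_I)^∼` (the easy inclusion of [IUTchIV] Prop. 1.1). [claim: Mochizuki2012, status: disputed] -/
theorem integerPacket_le_normalizedPacket : integerPacket p k ≤ normalizedPacket p k := by
  intro x hx
  rw [mem_normalizedPacket_iff]
  exact isIntegral_algebraMap (R := integerPacket p k) (A := PacketAlgebra p k) (x := ⟨x, hx⟩)

/-- If `x^E ∈ R_I` for some `E > 0` then `x ∈ (R_I)^∼`. [claim: Mochizuki2012, status: disputed] -/
theorem mem_normalizedPacket_of_pow_mem {x : PacketAlgebra p k} {E : ℕ} (hE : 0 < E)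
    (hx : x ^ E ∈ integerPacket p k) : x ∈ normalizedPacket p k := by
  rw [mem_normalizedPacket_iff]
  exact IsIntegral.of_pow hE ((mem_normalizedPacket_iff p k).mp
    (integerPacket_le_normalizedPacket p k hx))

/-- `(p^n)^E = p^{nE}`. [claim: Mochizuki2012, status: disputed] -/
theorem ppow_pow (n : ℤ) (E : ℕ) : ppow p k n ^ E = ppow p k (n * E) := by
  rw [ppow, ppow, ← map_pow, ← zpow_natCast, ← zpow_mul]

/-- `∏_i p^{M_i} = p^{Σ M_i}` in `ℚ_p`. [claim: Mochizuki2012, status: disputed] -/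
theorem prod_prime_zpow (s : Finset I) (M : I → ℤ) :
    ∏ i ∈ s, (p : ℚ_[p]) ^ M i = (p : ℚ_[p]) ^ ∑ i ∈ s, M i := by
  classical
  induction s using Finset.induction_on with
  | empty => simp
  | insert a s ha ih =>
    rw [Finset.prod_insert ha, Finset.sum_insert ha, ih, zpow_add₀ (PadicUniformizer.p_ne_zero' p)]

/-! ## Fractional `p`-powers: pure tensors of integral total order -/

section Fractional

variable [Fintype I] [∀ i, IsUltrametricDist (k i)] [∀ i, ProperSpace (k i)]

/-- `E := ∏_i e_i > 0`. [claim: Mochizuki2012, status: disputed] -/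
theorem prod_absRamificationIdx_pos : 0 < ∏ i, absRamificationIdx p (k i) :=
  Finset.prod_pos fun i _ ↦ absRamificationIdx_pos p (k i)

omit [Fact p.Prime] [Fintype I] [∀ i, IsUltrametricDist (k i)] [∀ i, ProperSpace (k i)] in
/-- Real arithmetic: `(p^{−m/e})^E = p^{−m·(E/e)}` for `e ∣ E`. [claim: Mochizuki2012, status: disputed] -/
theorem rpow_neg_div_pow {e E : ℕ} (he : 0 < e) (hdvd : e ∣ E) (m : ℤ) :
    ((p : ℝ) ^ (-((m : ℝ) / e))) ^ E = (p : ℝ) ^ (-((m * (E / e : ℕ) : ℤ) : ℝ)) := by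
  have hp0 : (0 : ℝ) ≤ p := by positivity
  have he' : (e : ℝ) ≠ 0 := by exact_mod_cast he.ne'
  rw [← Real.rpow_natCast, ← Real.rpow_mul hp0]
  congr 1
  rw [Int.cast_mul, Int.cast_natCast, Nat.cast_div hdvd he']
  field_simp

/-- **Pure tensors of integral total order are `p^n` times an element of `(R_I)^∼`.** If `c_i ∈ k_i^×`
and `Σ_i ord(c_i) ≥ n ∈ ℤ` (i.e. `∏_i ‖c_i‖ ≤ p^{−n}`), then `⊗_i c_i = p^n · y` with `y ∈ (R_I)^∼`:
for `E = ∏ e_i`, `(p^{−n}·⊗c_i)^E = p^{t}·⊗u_i` with `t ∈ ℕ` and units `u_i`, an element of `R_I`.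
This realises the "unspecified `p^λ`" bookkeeping of [IUTchIV] §1 inside `V` (proof of Prop. 1.2 (ii),
p. 11: `p^λ·(R_I)^∼ ⊆ p^{⌊λ−d_I−a_I⌋}·p^{d_I+a_I}·(R_I)^∼`). [claim: Mochizuki2012, status: disputed] -/
theorem exists_eq_ppow_mul_of_prod_norm_le [DecidableEq I] [Nonempty I] {c : Π i, k i}
    (hc : ∀ i, c i ≠ 0) {n : ℤ}
    (hn : ∏ i, ‖c i‖ ≤ (p : ℝ) ^ (-(n : ℝ))) :
    ∃ y ∈ normalizedPacket p k, purePacket p k c = ppow p k n * y := by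
  set E : ℕ := ∏ i, absRamificationIdx p (k i) with hE
  have hEpos : 0 < E := prod_absRamificationIdx_pos p k
  have hp1 : (1 : ℝ) < p := by exact_mod_cast (Fact.out : p.Prime).one_lt
  have hp0 : (0 : ℝ) < p := by positivity
  have hp0' := PadicUniformizer.p_ne_zero' p
  choose m hm using fun i ↦ exists_norm_eq_rpow p (k i) (hc i)
  have hdvd : ∀ i, absRamificationIdx p (k i) ∣ E := fun i ↦
    Finset.dvd_prod_of_mem _ (Finset.mem_univ i)
  let M : I → ℤ := fun i ↦ m i * (E / absRamificationIdx p (k i) : ℕ)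
  have hcE : ∀ i, ‖c i ^ E‖ = (p : ℝ) ^ (-(M i : ℝ)) := fun i ↦ by
    rw [norm_pow, hm i]
    exact rpow_neg_div_pow p (absRamificationIdx_pos p (k i)) (hdvd i) (m i)
  -- the units `u_i := p^{−M_i} c_i^E`
  let u : Π i, k i := fun i ↦ ((p : ℚ_[p]) ^ (-M i)) • (c i) ^ E
  have hu : ∀ i, ‖u i‖ ≤ 1 := fun i ↦ by
    have h : ‖u i‖ = 1 := by
      simp only [u, norm_smul, Padic.norm_p_zpow, hcE, neg_neg]
      rw [← Real.rpow_intCast, ← Real.rpow_add hp0, add_neg_cancel, Real.rpow_zero]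
    exact h.le
  have hcu : c ^ E = fun i ↦ ((p : ℚ_[p]) ^ (M i)) • u i := by
    funext i
    simp only [Pi.pow_apply, u, smul_smul, ← zpow_add₀ hp0', add_neg_cancel, zpow_zero, one_smul]
  -- the exponent `t := Σ M_i − nE ≥ 0`
  have hM : ∀ i, (M i : ℝ) = (m i : ℝ) / absRamificationIdx p (k i) * E := fun i ↦ by
    have he' : (absRamificationIdx p (k i) : ℝ) ≠ 0 := by
      exact_mod_cast (absRamificationIdx_pos p (k i)).ne'
    simp only [M]
    rw [Int.cast_mul, Int.cast_natCast, Nat.cast_div (hdvd i) he']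
    field_simp
  have hsum : (n : ℝ) * E ≤ ∑ i, (M i : ℝ) := by
    have h1 : ∏ i, ‖c i‖ = (p : ℝ) ^ (∑ i, -((m i : ℝ) / absRamificationIdx p (k i))) := by
      rw [Real.rpow_sum_of_pos hp0]
      exact Finset.prod_congr rfl fun i _ ↦ hm i
    rw [h1, Real.rpow_le_rpow_left_iff hp1, Finset.sum_neg_distrib, neg_le_neg_iff] at hn
    simp_rw [hM, ← Finset.sum_mul]
    exact mul_le_mul_of_nonneg_right hn (by positivity)
  have ht0 : (0 : ℤ) ≤ (∑ i, M i) - n * E := by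
    have : ((∑ i, M i) - n * E : ℤ) = ((∑ i, (M i : ℝ)) - n * E : ℝ) := by push_cast; ring
    exact_mod_cast (show (0 : ℝ) ≤ (((∑ i, M i) - n * E : ℤ) : ℝ) by rw [this]; linarith)
  -- `y := p^{−n} ⊗c_i`
  refine ⟨ppow p k (-n) * purePacket p k c, ?_, ?_⟩
  · apply mem_normalizedPacket_of_pow_mem p k hEpos
    rw [mul_pow, purePacket_pow, ppow_pow, hcu, purePacket_smul, prod_prime_zpow,
      Algebra.smul_def, ← mul_assoc, ppow, ← map_mul, ← zpow_add₀ hp0',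
      show -n * (E : ℤ) + ∑ i, M i = (∑ i, M i) - n * E by ring]
    exact mul_mem (ppow_mem_integerPacket p k ht0) (purePacket_mem_integerPacket p k hu)
  · rw [← mul_assoc, ppow_mul_neg_self, one_mul]

/-- Set form: `⊗c_i · (R_I)^∼ ⊆ p^n · (R_I)^∼` when `Σ ord(c_i) ≥ n`.
[claim: Mochizuki2012, status: disputed] -/
theorem purePacket_smul_normalizedPacket_subset [DecidableEq I] [Nonempty I] {c : Π i, k i}
    (hc : ∀ i, c i ≠ 0) {n : ℤ}
    (hn : ∏ i, ‖c i‖ ≤ (p : ℝ) ^ (-(n : ℝ))) :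
    purePacket p k c • (normalizedPacket p k : Set (PacketAlgebra p k)) ⊆
      ppow p k n • (normalizedPacket p k : Set (PacketAlgebra p k)) := by
  obtain ⟨y, hy, hcy⟩ := exists_eq_ppow_mul_of_prod_norm_le p k hc hn
  rintro _ ⟨z, hz, rfl⟩
  refine ⟨y * z, mul_mem hy hz, ?_⟩
  simp only [smul_eq_mul, hcy, mul_assoc]

/-- **Comparison of two "`p^μ`"s.** If `G = p^a·⊗c_i` and `G' = p^{a'}·⊗c'_i` (all `c'_i ≠ 0`, `c_i ≠ 0`)
with `ord(G) ≥ ord(G')`, i.e. `p^{−a}·∏‖c_i‖ ≤ p^{−a'}·∏‖c'_i‖`, then `G·(R_I)^∼ ⊆ G'·(R_I)^∼`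
(`G = G'·(G/G')` with `G/G' ∈ (R_I)^∼`). [claim: Mochizuki2012, status: disputed] -/
theorem smul_normalizedPacket_subset_of_prod_norm_le [DecidableEq I] [Nonempty I] {c c' : Π i, k i}
    (hc : ∀ i, c i ≠ 0) (hc' : ∀ i, c' i ≠ 0) {a a' : ℤ}
    (h : (p : ℝ) ^ (-(a : ℝ)) * ∏ i, ‖c i‖ ≤ (p : ℝ) ^ (-(a' : ℝ)) * ∏ i, ‖c' i‖) :
    (ppow p k a * purePacket p k c) • (normalizedPacket p k : Set (PacketAlgebra p k)) ⊆
      (ppow p k a' * purePacket p k c') • (normalizedPacket p k : Set (PacketAlgebra p k)) := by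
  have hp0 : (0 : ℝ) < p := by exact_mod_cast (Fact.out : p.Prime).pos
  -- the quotient `⊗(c_i / c'_i)` has `∏ ‖c_i/c'_i‖ ≤ p^{−(a' − a)}`
  have hq : ∏ i, ‖c i / c' i‖ ≤ (p : ℝ) ^ (-((a' - a : ℤ) : ℝ)) := by
    have hpos : 0 < ∏ i, ‖c' i‖ := Finset.prod_pos fun i _ ↦ norm_pos_iff.mpr (hc' i)
    simp_rw [norm_div, Finset.prod_div_distrib]
    rw [div_le_iff₀ hpos]
    have e1 : (p : ℝ) ^ (-((a' - a : ℤ) : ℝ)) = (p : ℝ) ^ (-(a' : ℝ)) / (p : ℝ) ^ (-(a : ℝ)) := by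
      rw [← Real.rpow_sub hp0]; push_cast; ring_nf
    rw [e1, div_mul_eq_mul_div, le_div_iff₀ (Real.rpow_pos_of_pos hp0 _)]
    linarith [mul_comm ((p : ℝ) ^ (-(a : ℝ))) (∏ i, ‖c i‖)]
  obtain ⟨y, hy, hcy⟩ :=
    exists_eq_ppow_mul_of_prod_norm_le p k (fun i ↦ div_ne_zero (hc i) (hc' i)) hq
  -- `⊗c = ⊗c' · ⊗(c/c') = ⊗c' · p^{a'−a} · y`
  have hcc : purePacket p k c = purePacket p k c' * (ppow p k (a' - a) * y) := by
    rw [← hcy, purePacket_mul]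
    congr 1
    funext i
    exact (by rw [Pi.mul_apply, mul_comm, div_mul_cancel₀ _ (hc' i)] :
      (c' * fun i ↦ c i / c' i) i = c i).symm
  rintro _ ⟨z, hz, rfl⟩
  refine ⟨y * z, mul_mem hy hz, ?_⟩
  simp only [smul_eq_mul, hcc]
  rw [show ppow p k a * (purePacket p k c' * (ppow p k (a' - a) * y)) * z =
      (ppow p k a * ppow p k (a' - a)) * purePacket p k c' * (y * z) by ring,
    ← ppow_add, show a + (a' - a) = a' by ring]

end Fractional

end Literature.IUT.LogVolume

end
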